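import Mathlib.Algebra.Order.BigOperators.Ring.Finset
import Mathlib.Algebra.Order.Field.Basic
import Mathlib.Algebra.Ring.Parity
import Mathlib.Data.Real.Basic
import Mathlib.Tactic.Linarith
import Mathlib.Tactic.NormNum
import Mathlib.Tactic.Ring
import Mathlib.Tactic.Positivity
import Mathlib.Tactic.FieldSimp
import Mathlib.Tactic.IntervalCases
import HarnessLib

/-!
# Bhargava–Skinner–Zhang 2014, Thms 21, 23, 25: the Selmer-rank linear programmes for a general prime `p` (abstract counting form)

Source: M. Bhargava, C. Skinner, W. Zhang, *A majority of elliptic curves over `ℚ` satisfy the Birch and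
Swinnerton-Dyer conjecture*, arXiv:1407.1826v2 (2014) [BhargavaSkinnerZhang2014], §3: Thm 21 (p. 11; rank `0`:
`(p-2)/(2p-2)`), Thm 23 (p. 12; rank `1`: `(p²-p-1)/(2p²-2p)`), Thm 25 (p. 13; rank `0` or `1`: `(p²-p-1)/(p²-1)`
without, `(2p-3)/(2p-2)` with equidistributed parity) and the way Cor 26 (p. 13) combines the two parts of Thm 25.
Page numbers are those of the compiled arXiv v2 PDF (checked by the `pub-bsdpct` literature audit, 2026-08-18).

Reproduction (proved, Mathlib-only): the three bounds as FINITE counting inequalities with explicit error terms,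
for an arbitrary finite set `s` of "curves" indexed by a type `ι` and carrying a "Selmer rank" `r : ι → ℕ` (so that
`#Sel_p = p ^ r`), under
* an average bound `∑_{s} p ^ r ≤ (p + 1 + η) · #s` (Bhargava–Shankar: the average size of the `p`-Selmer group in
  a large family is `p + 1`, source Thm 13; `η` is the finite-height slack), and
* parity information on a subset `U ⊆ s`: at least `#U / 2 - E` members of `U` have odd (resp. even) `r` (root
  numbers equidistributed in `U` + Dokchitser–Dokchitser `p`-parity, source Thm 15, + `E(ℚ)[p] = 0` off an
  exceptional set of size `≤ E`).
The proofs are one pointwise inequality each (`pow_ge_*`), summed over `s`.  The combined form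
`card_rank_le_one_ge` (parity used on `U ⊆ s`, the average used once on `s`) gives
`#{r ≤ 1} ≥ ((p²-p-1-η)·#s + (p-1)(#U/2 - E)) / (p²-1)`, i.e. the factor
`(p²-p-1)/(p²-1) + κ (p-1)/(2(p²-1)) = κ·(2p-3)/(2p-2) + (1-κ)·(p²-p-1)/(p²-1)` at `#U = κ·#s`
(`19/24 + κ/12` for `p = 5`, `5/8 + κ/8` for `p = 3`), which is how Cor 26 of the source combines the two parts
of Thm 25.

Relation to the tree: `Literature.NumberTheory.EllipticCurves.thm25_count`, `thm25_count_of_subfamily`,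
`thm21_count`, `thm23_count` (`LeadingTermBSZProofs.lean`) are the SAME three theorems stated over the CONCRETE
invariants of `shortWeierstrass (A, B)` at a finite height (`Nat.card (selmerGroup · p)`, root numbers, torsion);
the present file is the abstract counting core over a bare rank function, which the multi-cell bookkeeping of the
`pub-bsdpct` bundle (BirchSwinnertonDyer / bsd-percentage) consumes for every prime and every averaging family at once.
Origin: `BSDPercentage/SelmerCombinatorics.lean` of that bundle's staged package (run of record 72), namespace
rewritten `BSDPercentage → Literature.NumberTheory.EllipticCurves.BhargavaSkinnerZhang2014` (LEAN-IN-TREE rule, 2026-08-18).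

What is NOT here: the inputs themselves (Selmer averages, parity, equidistribution of root numbers — they are
hypotheses of the counting theorems, exactly as used), densities / limits in the height (see the bundle's cell
bookkeeping), and anything specific to `p = 5` beyond the sanity check `factors_five_and_three`.
-/

namespace Literature.NumberTheory.EllipticCurves.BhargavaSkinnerZhang2014

open Finset

section Pointwise

variable {p : ℕ}

/-- Pointwise inequality behind Thm 25 (both parts at once):
`p ^ n ≥ 1 + (p² - 1)·[n ≥ 2] + (p - 1)·[n odd]` for every `n` and every `p ≥ 2`.
(`n = 0`: `1`; `n = 1`: `p`; `n = 2`: `p²`; `n ≥ 3`: `p ^ n ≥ p³ ≥ p² + p - 1`.)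
[cite: BhargavaSkinnerZhang2014, Thm 25 (proof)] -/
theorem pow_ge_both (hp : 2 ≤ p) (n : ℕ) :
    1 + ((p : ℝ) ^ 2 - 1) * (if n ≤ 1 then 0 else 1) + ((p : ℝ) - 1) * (if Odd n then 1 else 0)
      ≤ (p : ℝ) ^ n := by
  have hp2 : (2 : ℝ) ≤ p := by exact_mod_cast hp
  rcases Nat.lt_or_ge n 3 with hn | hn
  · interval_cases n
    · simp
    · norm_num
    · have h2 : ¬ Odd 2 := by decide
      simp [h2]
  · have h3 : (p : ℝ) ^ 3 ≤ (p : ℝ) ^ n := pow_le_pow_right₀ (by linarith) hn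
    have hcube : (p : ℝ) ^ 2 + p - 1 ≤ (p : ℝ) ^ 3 := by nlinarith
    split_ifs <;> first | (exfalso; omega) | nlinarith

/-- Pointwise inequality behind Thm 21 (rank `0`):
`p ^ n ≥ 1 + (p - 1)·[n odd] + (p² - 1)·[n even, n ≠ 0]`. [cite: BhargavaSkinnerZhang2014, Thm 21 (proof)] -/
theorem pow_ge_rank_zero (hp : 2 ≤ p) (n : ℕ) :
    1 + ((p : ℝ) - 1) * (if Odd n then 1 else 0) + ((p : ℝ) ^ 2 - 1) * (if Even n ∧ n ≠ 0 then 1 else 0)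
      ≤ (p : ℝ) ^ n := by
  have hp2 : (2 : ℝ) ≤ p := by exact_mod_cast hp
  rcases Nat.lt_or_ge n 3 with hn | hn
  · interval_cases n
    · simp
    · norm_num
    · have h2 : ¬ Odd 2 := by decide
      have h2' : Even 2 := by decide
      simp [h2, h2']
  · have h3 : (p : ℝ) ^ 3 ≤ (p : ℝ) ^ n := pow_le_pow_right₀ (by linarith) hn
    have hcube : (p : ℝ) ^ 2 + p - 1 ≤ (p : ℝ) ^ 3 := by nlinarith
    split_ifs <;> nlinarith

/-- Pointwise inequality behind Thm 23 (rank `1`):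
`p ^ n ≥ 1 + (p - 1)·[n odd] + (p³ - p)·[n odd, n ≠ 1]`. [cite: BhargavaSkinnerZhang2014, Thm 23 (proof)] -/
theorem pow_ge_rank_one (hp : 2 ≤ p) (n : ℕ) :
    1 + ((p : ℝ) - 1) * (if Odd n then 1 else 0) + ((p : ℝ) ^ 3 - p) * (if Odd n ∧ n ≠ 1 then 1 else 0)
      ≤ (p : ℝ) ^ n := by
  have hp2 : (2 : ℝ) ≤ p := by exact_mod_cast hp
  rcases Nat.lt_or_ge n 3 with hn | hn
  · interval_cases n
    · simp
    · norm_num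
    · have h2 : ¬ Odd 2 := by decide
      simp [h2]
      nlinarith
  · have h3 : (p : ℝ) ^ 3 ≤ (p : ℝ) ^ n := pow_le_pow_right₀ (by linarith) hn
    have hcube : (p : ℝ) ^ 2 + p - 1 ≤ (p : ℝ) ^ 3 := by nlinarith
    split_ifs <;> nlinarith

end Pointwise

section Counting

variable {ι : Type*} {p : ℕ}

/-- **Thm 25 of the source, both parts in one counting inequality.** If `∑_{s} p ^ r ≤ (p + 1 + η)·#s` and
at least `#U/2 - E` members of `U ⊆ s` have odd `r`, then
`(p² - 1)·#{i ∈ s | r i ≤ 1} ≥ (p² - p - 1 - η)·#s + (p - 1)·(#U/2 - E)`.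
[cite: BhargavaSkinnerZhang2014, Thm 25 and Cor 26 (proof)] -/
theorem card_rank_le_one_ge (hp : 2 ≤ p) (s U : Finset ι) (r : ι → ℕ) (hU : U ⊆ s) {η E : ℝ}
    (h13 : ∑ i ∈ s, (p : ℝ) ^ r i ≤ (p + 1 + η) * s.card)
    (hodd : (U.card : ℝ) / 2 - E ≤ (U.filter fun i ↦ Odd (r i)).card) :
    ((p : ℝ) ^ 2 - p - 1 - η) * s.card + ((p : ℝ) - 1) * (U.card / 2 - E)
      ≤ ((p : ℝ) ^ 2 - 1) * (s.filter fun i ↦ r i ≤ 1).card := by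
  have hp2 : (2 : ℝ) ≤ p := by exact_mod_cast hp
  -- sum the pointwise inequality over `s`
  have hsum : ∑ i ∈ s, (1 + ((p : ℝ) ^ 2 - 1) * (if r i ≤ 1 then 0 else 1)
      + ((p : ℝ) - 1) * (if Odd (r i) then 1 else 0)) ≤ ∑ i ∈ s, (p : ℝ) ^ r i :=
    Finset.sum_le_sum fun i _ ↦ pow_ge_both hp (r i)
  rw [Finset.sum_add_distrib, Finset.sum_add_distrib, ← Finset.mul_sum, ← Finset.mul_sum] at hsum
  -- evaluate the three sums
  have h1 : ∑ i ∈ s, (1 : ℝ) = s.card := by simp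
  have h2 : ∑ i ∈ s, (if r i ≤ 1 then (0 : ℝ) else 1) = s.card - (s.filter fun i ↦ r i ≤ 1).card := by
    have := Finset.card_filter_add_card_filter_not (s := s) (fun i ↦ r i ≤ 1)
    have hb : ∑ i ∈ s, (if r i ≤ 1 then (0 : ℝ) else 1) = (s.filter fun i ↦ ¬ r i ≤ 1).card := by
      rw [← Finset.sum_boole]
      exact Finset.sum_congr rfl fun i _ ↦ by split_ifs <;> simp_all
    rw [hb]
    have : ((s.filter fun i ↦ r i ≤ 1).card : ℝ) + (s.filter fun i ↦ ¬ r i ≤ 1).card = s.card := by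
      exact_mod_cast this
    linarith
  have h3 : ∑ i ∈ U, (if Odd (r i) then (1 : ℝ) else 0) ≤ ∑ i ∈ s, (if Odd (r i) then (1 : ℝ) else 0) :=
    Finset.sum_le_sum_of_subset_of_nonneg hU fun i _ _ ↦ by split_ifs <;> norm_num
  have h4 : ∑ i ∈ U, (if Odd (r i) then (1 : ℝ) else 0) = (U.filter fun i ↦ Odd (r i)).card := by
    rw [← Finset.sum_boole]
  rw [h1, h2] at hsum
  have hp1 : 0 ≤ (p : ℝ) - 1 := by linarith
  have h5 : ((p : ℝ) - 1) * (U.card / 2 - E) ≤ ((p : ℝ) - 1) * ∑ i ∈ s, (if Odd (r i) then (1 : ℝ) else 0) :=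
    mul_le_mul_of_nonneg_left (by linarith) hp1
  nlinarith

/-- **Thm 21 of the source (rank `0`), counting form.** If `∑_{U} p ^ r ≤ (p + 1 + η)·#U` and at least
`#U/2 - E` members of `U` have odd `r` and at least `#U/2 - E` have even `r`, then
`(p² - 1)·#{i ∈ U | r i = 0} ≥ ((p² - p - 2)/2 - η)·#U - (p² + p - 2)·E`.
[cite: BhargavaSkinnerZhang2014, Thm 21 (proof)] -/
theorem card_rank_zero_ge (hp : 2 ≤ p) (U : Finset ι) (r : ι → ℕ) {η E : ℝ}
    (h13 : ∑ i ∈ U, (p : ℝ) ^ r i ≤ (p + 1 + η) * U.card)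
    (hodd : (U.card : ℝ) / 2 - E ≤ (U.filter fun i ↦ Odd (r i)).card)
    (heven : (U.card : ℝ) / 2 - E ≤ (U.filter fun i ↦ Even (r i)).card) :
    (((p : ℝ) ^ 2 - p - 2) / 2 - η) * U.card - ((p : ℝ) ^ 2 + p - 2) * E
      ≤ ((p : ℝ) ^ 2 - 1) * (U.filter fun i ↦ r i = 0).card := by
  have hp2 : (2 : ℝ) ≤ p := by exact_mod_cast hp
  have hsum : ∑ i ∈ U, (1 + ((p : ℝ) - 1) * (if Odd (r i) then 1 else 0)
      + ((p : ℝ) ^ 2 - 1) * (if Even (r i) ∧ r i ≠ 0 then 1 else 0)) ≤ ∑ i ∈ U, (p : ℝ) ^ r i :=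
    Finset.sum_le_sum fun i _ ↦ pow_ge_rank_zero hp (r i)
  rw [Finset.sum_add_distrib, Finset.sum_add_distrib, ← Finset.mul_sum, ← Finset.mul_sum] at hsum
  have h1 : ∑ i ∈ U, (1 : ℝ) = U.card := by simp
  have h2 : ∑ i ∈ U, (if Odd (r i) then (1 : ℝ) else 0) = (U.filter fun i ↦ Odd (r i)).card := by
    rw [← Finset.sum_boole]
  have h3 : ∑ i ∈ U, (if Even (r i) ∧ r i ≠ 0 then (1 : ℝ) else 0)
      = (U.filter fun i ↦ Even (r i)).card - (U.filter fun i ↦ r i = 0).card := by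
    have hb : ∑ i ∈ U, (if Even (r i) ∧ r i ≠ 0 then (1 : ℝ) else 0)
        = (U.filter fun i ↦ Even (r i) ∧ r i ≠ 0).card := by rw [← Finset.sum_boole]
    have hsplit := Finset.card_filter_add_card_filter_not
      (s := U.filter fun i ↦ Even (r i)) (fun i ↦ r i = 0)
    rw [Finset.filter_filter, Finset.filter_filter] at hsplit
    have e1 : (U.filter fun i ↦ Even (r i) ∧ r i = 0) = U.filter fun i ↦ r i = 0 := by
      ext i; simp only [Finset.mem_filter, and_congr_right_iff]
      exact fun _ ↦ ⟨fun h ↦ h.2, fun h ↦ ⟨by simp [h], h⟩⟩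
    rw [e1] at hsplit
    rw [hb]
    have : ((U.filter fun i ↦ r i = 0).card : ℝ) + (U.filter fun i ↦ Even (r i) ∧ ¬ r i = 0).card
        = (U.filter fun i ↦ Even (r i)).card := by exact_mod_cast hsplit
    linarith
  rw [h1, h2, h3] at hsum
  have hp1 : 0 ≤ (p : ℝ) - 1 := by linarith
  have hp3 : 0 ≤ (p : ℝ) ^ 2 - 1 := by nlinarith
  have h5 := mul_le_mul_of_nonneg_left hodd hp1
  have h6 := mul_le_mul_of_nonneg_left heven hp3
  nlinarith

/-- **Thm 23 of the source (rank `1`), counting form.** If `∑_{U} p ^ r ≤ (p + 1 + η)·#U` and at least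
`#U/2 - E` members of `U` have odd `r`, then
`(p³ - p)·#{i ∈ U | r i = 1} ≥ ((p³ - 1)/2 - p - η)·#U - (p³ - 1)·E`.
[cite: BhargavaSkinnerZhang2014, Thm 23 (proof)] -/
theorem card_rank_one_ge (hp : 2 ≤ p) (U : Finset ι) (r : ι → ℕ) {η E : ℝ}
    (h13 : ∑ i ∈ U, (p : ℝ) ^ r i ≤ (p + 1 + η) * U.card)
    (hodd : (U.card : ℝ) / 2 - E ≤ (U.filter fun i ↦ Odd (r i)).card) :
    (((p : ℝ) ^ 3 - 1) / 2 - p - η) * U.card - ((p : ℝ) ^ 3 - 1) * E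
      ≤ ((p : ℝ) ^ 3 - p) * (U.filter fun i ↦ r i = 1).card := by
  have hp2 : (2 : ℝ) ≤ p := by exact_mod_cast hp
  have hsum : ∑ i ∈ U, (1 + ((p : ℝ) - 1) * (if Odd (r i) then 1 else 0)
      + ((p : ℝ) ^ 3 - p) * (if Odd (r i) ∧ r i ≠ 1 then 1 else 0)) ≤ ∑ i ∈ U, (p : ℝ) ^ r i :=
    Finset.sum_le_sum fun i _ ↦ pow_ge_rank_one hp (r i)
  rw [Finset.sum_add_distrib, Finset.sum_add_distrib, ← Finset.mul_sum, ← Finset.mul_sum] at hsum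
  have h1 : ∑ i ∈ U, (1 : ℝ) = U.card := by simp
  have h2 : ∑ i ∈ U, (if Odd (r i) then (1 : ℝ) else 0) = (U.filter fun i ↦ Odd (r i)).card := by
    rw [← Finset.sum_boole]
  have h3 : ∑ i ∈ U, (if Odd (r i) ∧ r i ≠ 1 then (1 : ℝ) else 0)
      = (U.filter fun i ↦ Odd (r i)).card - (U.filter fun i ↦ r i = 1).card := by
    have hb : ∑ i ∈ U, (if Odd (r i) ∧ r i ≠ 1 then (1 : ℝ) else 0)
        = (U.filter fun i ↦ Odd (r i) ∧ r i ≠ 1).card := by rw [← Finset.sum_boole]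
    have hsplit := Finset.card_filter_add_card_filter_not
      (s := U.filter fun i ↦ Odd (r i)) (fun i ↦ r i = 1)
    rw [Finset.filter_filter, Finset.filter_filter] at hsplit
    have e1 : (U.filter fun i ↦ Odd (r i) ∧ r i = 1) = U.filter fun i ↦ r i = 1 := by
      ext i; simp only [Finset.mem_filter, and_congr_right_iff]
      exact fun _ ↦ ⟨fun h ↦ h.2, fun h ↦ ⟨by simp [h], h⟩⟩
    rw [e1] at hsplit
    rw [hb]
    have : ((U.filter fun i ↦ r i = 1).card : ℝ) + (U.filter fun i ↦ Odd (r i) ∧ ¬ r i = 1).card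
        = (U.filter fun i ↦ Odd (r i)).card := by exact_mod_cast hsplit
    linarith
  rw [h1, h2, h3] at hsum
  have hp1 : 0 ≤ (p : ℝ) - 1 := by linarith
  have hp3 : 0 ≤ (p : ℝ) ^ 3 - p := by
    have e : (p : ℝ) ^ 3 - p = p * (p ^ 2 - 1) := by ring
    rw [e]
    exact mul_nonneg (by linarith) (by nlinarith)
  have h5 := mul_le_mul_of_nonneg_left hodd hp1
  have h6 := mul_le_mul_of_nonneg_left hodd hp3
  nlinarith

/-- The three factors of the source at `p = 5` (sanity check of the constants): `(p²-p-1)/(p²-1) = 19/24`,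
`(p-1)/(2(p²-1)) = 1/12`, `(p²-p-2)/(2(p²-1)) = 3/8`, `((p³-1)/2 - p)/(p³-p) = 19/40`; and at `p = 3`:
`5/8`, `1/8`, `1/4`, `5/12`. [cite: BhargavaSkinnerZhang2014, Thms 21, 23, 25] -/
theorem factors_five_and_three :
    ((5 : ℚ) ^ 2 - 5 - 1) / (5 ^ 2 - 1) = 19 / 24 ∧ ((5 : ℚ) - 1) / (2 * (5 ^ 2 - 1)) = 1 / 12 ∧
    ((5 : ℚ) ^ 2 - 5 - 2) / (2 * (5 ^ 2 - 1)) = 3 / 8 ∧ (((5 : ℚ) ^ 3 - 1) / 2 - 5) / (5 ^ 3 - 5) = 19 / 40 ∧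
    ((3 : ℚ) ^ 2 - 3 - 1) / (3 ^ 2 - 1) = 5 / 8 ∧ ((3 : ℚ) - 1) / (2 * (3 ^ 2 - 1)) = 1 / 8 ∧
    ((3 : ℚ) ^ 2 - 3 - 2) / (2 * (3 ^ 2 - 1)) = 1 / 4 ∧ (((3 : ℚ) ^ 3 - 1) / 2 - 3) / (3 ^ 3 - 3) = 5 / 12 := by
  norm_num

end Counting

end Literature.NumberTheory.EllipticCurves.BhargavaSkinnerZhang2014
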